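/- Copyright: the b2b-balaban cell (near-miss cell 7), T⁴-continuum fan-out; row NE7b CRUX team (2), OWNER seat
t4-ne7b-p1 (gen 54) — INTERFACE REQUEST NE7b IR-54-1 «(α)-JOINT», item (J3a): the joint DATUM.  Released under the
licence of the surrounding project. -/
import Literature.MathematicalPhysics.QuantumFieldTheory.Balaban1983to89.T4FiniteEpsInhabited
import Literature.MathematicalPhysics.QuantumFieldTheory.Balaban1983to89.T4ContinuumYM4Torus
import Literature.MathematicalPhysics.QuantumFieldTheory.Balaban1983to89.T4StabilitySocket

/-!
# (α)-JOINT, part 2: A FINITE-ε DATUM ON WHICH (B) ∧ `BetaPertHyp` ∧ `IsBlockAveraged` HOLD, WITH A RUNNING COUPLING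
(INTERFACE REQUEST NE7b IR-54-1 (J3a); owner lineage `t4-ne7b-p1` gen 54)

Summits-side support leaf of the T⁴-continuum cell (rung (B)+1 on a FINITE torus only; NOT infinite volume, NOT the
mass gap, NOT Clay; NOT a proof of NE7b — the cell's OWN estimate, NOT PRINTED, NOT PROVED).  [decided toy] A datum
`jointData F : FiniteEpsData F SU(1)` built on the pattern of the tree's placeholder `T4FiniteEpsInhabited.stubData`
and of leaf-05's `toyData` (χ := 1), with THREE changes, and the elementary facts about it; nothing printed asserted,
no `def … : Prop` fact, no cite-tagged hypothesis, zero `sorry`.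

WHY (owner item (α)-JOINT, journal `CLAIMS.log` l.36187; `HOME/INBOX.md` IR-54-1).  Every inhabitation on file of the
(α) record is on `toyData`, where (B) FAILS (`not_endStatementBPrinted_toy`: `Sect2Form := False`) and the coupling
flow is CONSTANT (`βfun := 0`, so `BetaPertHyp` fails too: it asks `|β − β̄| ≤ Cγ²` with `β̄ > 0`).  The terminal
theorem of record `continuumYM4Torus_of_histReadingLWL_fsc` (p303949) takes `hB : EndStatementBPrinted D.C` AND
`hβ : BetaPertHyp D.βfun` AND the record under `ForSmallCouplings D` — non-vacuous exactly when tuned bare sequences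
exist (`T4ContinuumYM4Torus.ForSmallCouplings.of_no_tuned` is the vacuity source by name), which `BetaPertHyp` forces
(`exists_tuned_of_betaPertHyp`).  A joint witness therefore needs a datum with a RUNNING flow on which (B) holds; this
file builds the cheapest one.

WHAT.  §1 `SU(1) = Matrix.specialUnitaryGroup (Fin 1) ℂ` IS A ONE-POINT GROUP (`Subsingleton`, by `det = 1` on `1×1`
unitaries; `N = 1` is admitted by the terminal's `[NeZero N]`): every gauge field on it is the trivial one (`Unique`),
every probability measure integrates `f` to `f default` (`integral_unique_prob`), every `reTr` is `1`, every Wilson action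
is `0`, every Boltzmann weight and every loop variable is `1`.  §2 THE CONSTANT β-FAMILY `constHBeta β̄` and the
ONE-LOOP FORWARD FLOW `olFlow β̄ g₀` it generates (`1∕g_{k+1}² = 1∕g_k² − β̄`, the positive root, frozen where the guard
`1∕g_k² − β̄ > 0` fails — VERBATIM the recursion `DagBinding.ForwardGenerated` prescribes); `betaPertHyp_constHBeta`
(`β̄ := 1`: `|1 − 1| ≤ 0·γ²`, constants are continuous).  §3 THE DATUM: `jointConstruction F` = the placeholder
construction over `SU(1)` with (i) flow `olFlow 1 g₀`, β-functions `≡ 1`; (ii) `Sect2Form := True`, `χ := 1`,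
`ρ := 1` (every density of the one-point theory IS `1`); (iii) `numSites := 0`, `wilsonBG := 0` as in the stub;
`jointRealisation` (`ρ₀ = 1 = 1·e^{−g₀⁻²·0}` HONESTLY — the Boltzmann weight of `SU(1)` is `1`; `Tρ := 1` IS the
renormalisation transform of `1` along ANY averaging on a one-point configuration space, `isRT_one_SU1`; `R := id`);
**`jointData F : FiniteEpsData F SU(1)`** with the trivial small-loop block averaging.  §4 THE BINDERS IT MEETS:
**`endStatementBPrinted_jointData`** ((B): Theorem 1's form-clause is `True`; [III] Cor. 3 (2.50) reads
`1·e^{−0−0} ≤ 1 ≤ e^{0}` at `e_± := 0`), **`betaPertHyp_jointData`**, `signConventions_jointData`,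
**`isBlockAveraged_jointData`** (trivial `ℰ`, `measurableE_trivial`), `avgMeasurable_jointData`; and the datum's
integrals: `dens_jointData` (`≡ 1`), `smallFieldMass_jointData = 1`, `numSites_jointData = 0`, `avgObs_jointData = 1`,
**`exists_tuned_jointData`** (tuned bare sequences exist for all small `γ`, `g` — the ∀ of `ForSmallCouplings` is NOT
over an empty range on this datum).

HONEST.  A decided toy on OUR carriers at the degenerate group `SU(1)`: it models NOTHING of Bałaban's (no field, no
action, no large field; (B) holds because its form-clause is abstract and its inequality degenerates to `1 ≤ 1 ≤ 1`);
its only use is part (J3b): the TERMINAL theorem of record APPLIED with every binder discharged, i.e. a certificate that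
the road's HYPOTHESIS SET is jointly satisfiable with a non-vacuous `ForSmallCouplings` range.  BY-NAME EFFECT ON THE
WALL: NONE; every R-class row stays; NE7b NOT PRINTED ∕ NOT PROVED; spine 0∕9.  HONEST DEPENDENCY (cell): continuum YM
on T⁴ ⇐ BetaPertH ∧ nine spine estimates (0/9 proved); BetaPertH ⇐ (D1) ∧ (D4) ∧ CAP+tail; G-an2-4 gates asym, D1 and
NE2/3/4.  Unchanged here.
-/

open MeasureTheory
open Literature.MathematicalPhysics.QuantumFieldTheory.Balaban1983to89
open Literature.MathematicalPhysics.QuantumFieldTheory.Balaban1983to89.T4Continuum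
open Literature.MathematicalPhysics.QuantumFieldTheory.Balaban1983to89.T4FiniteEpsInhabited
open Literature.MathematicalPhysics.QuantumFieldTheory.Balaban1983to89.T4StabilitySocket (smallFieldMass)

namespace Summit.QuantumFields.BalabanUV.T4Continuum.HistoryRealiseCellsRunAssemblyWTVSJointDatum

noncomputable section

/-! ## §1 `SU(1)` is a one-point group -/

/-- shorthand for the degenerate gauge group `SU(1)` [decided toy] -/
abbrev SU1 : Type := Matrix.specialUnitaryGroup (Fin 1) ℂ

/-- `SU(1)` has exactly one element: a `1×1` unitary of determinant `1` is `1`. [folklore] -/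
instance subsingleton_SU1 : Subsingleton SU1 := by
  refine ⟨fun A B => Subtype.ext ?_⟩
  have hA := A.2
  have hB := B.2
  rw [Matrix.mem_specialUnitaryGroup_iff] at hA hB
  ext i j
  have hi : i = 0 := Subsingleton.elim _ _
  have hj : j = 0 := Subsingleton.elim _ _
  subst hi; subst hj
  rw [← Matrix.det_fin_one (A : Matrix (Fin 1) (Fin 1) ℂ), ← Matrix.det_fin_one (B : Matrix (Fin 1) (Fin 1) ℂ),
    hA.2, hB.2]

/-- its element [folklore] -/
instance inhabited_SU1 : Inhabited SU1 := ⟨1⟩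

variable (P : Params) (j : ℕ)

/-- gauge fields on a one-point group: one configuration [folklore] -/
instance subsingleton_gaugeField_SU1 : Subsingleton (GaugeField P j SU1) :=
  inferInstanceAs (Subsingleton (PBond P j → SU1))

/-- … the trivial one [folklore] -/
instance unique_gaugeField_SU1 : Unique (GaugeField P j SU1) := Unique.mk' _

variable {P j}

/-- on a `Unique` measurable space a probability measure integrates `f` to `f default` [folklore] -/
theorem integral_unique_prob {X : Type*} [MeasurableSpace X] [Unique X] (μ : Measure X) [IsProbabilityMeasure μ]
    (f : X → ℝ) : ∫ x, f x ∂μ = f default := by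
  have : f = fun _ => f default := funext fun x => by rw [Unique.eq_default x]
  rw [this, integral_const, smul_eq_mul]
  simp

/-- every real trace on `SU(1)` is `reTr 1 = 1` [folklore] -/
theorem reTr_SU1 (u : SU1) : GaugeGroup.reTr u = 1 := by
  rw [Subsingleton.elim u 1]; exact GaugeGroup.reTr_one

/-- every Wilson action on `SU(1)` vanishes [folklore] -/
theorem wilsonAction_SU1 (w : ℝ) (U : GaugeField P j SU1) : wilsonAction w U = 0 := by
  unfold wilsonAction
  exact Finset.sum_eq_zero fun p _ => by rw [reTr_SU1, sub_self, mul_zero]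

/-- every Boltzmann weight on `SU(1)` is `1` [folklore] -/
theorem boltzmann_SU1 (β : ℝ) (U : GaugeField P 0 SU1) : Missing.boltzmann P β U = 1 := by
  unfold Missing.boltzmann wilsonAction4
  rw [wilsonAction_SU1, mul_zero]; simp

/-- every loop variable on `SU(1)` is `1` [folklore] -/
theorem loopAt_SU1 (U : GaugeField P j SU1) (γ : List (LStep P j)) : loopAt U γ = 1 := by
  unfold loopAt; exact reTr_SU1 _

/-- `1` IS the renormalisation transform of `1` along ANY averaging on `SU(1)` (both sides of the push-forward identity
are `f default`) [folklore] -/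
theorem isRT_one_SU1 (avg : GaugeField P j SU1 → GaugeField P (j + 1) SU1) :
    IsRT avg (fun _ => (1 : ℝ)) (fun _ => (1 : ℝ)) := by
  intro f _ _
  rw [integral_unique_prob, integral_unique_prob, Unique.eq_default (avg default)]

/-! ## §2 The constant β-family and the one-loop forward flow it generates -/

/-- the constant history family `β_{k+1} ≡ β̄` [folklore] -/
def constHBeta (βbar : ℝ) : FlowStep.HBeta := fun _ _ => βbar

/-- **THE ONE-LOOP FORWARD FLOW** from the bare coupling `g₀`: `g_0 = g₀`, `g_{k+1} = (1∕g_k² − β̄)^{−1∕2}` when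
`1∕g_k² − β̄ > 0`, else frozen (`g_{k+1} = g_k`) — the forward solution of [Balaban1987RG1] (0.20) for `β ≡ β̄`,
exactly as `DagBinding.ForwardGenerated` prescribes it. [folklore] -/
def olFlow (βbar g0 : ℝ) : ℕ → ℝ
  | 0 => g0
  | k + 1 =>
      if 0 < 1 / (olFlow βbar g0 k) ^ 2 - βbar then 1 / Real.sqrt (1 / (olFlow βbar g0 k) ^ 2 - βbar)
      else olFlow βbar g0 k

/-- the flow starts at the bare coupling [folklore] -/
@[simp] theorem olFlow_zero (βbar g0 : ℝ) : olFlow βbar g0 0 = g0 := rfl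

/-- the guarded step, unfolded [folklore] -/
theorem olFlow_succ_of_pos {βbar g0 : ℝ} {k : ℕ} (h : 0 < 1 / (olFlow βbar g0 k) ^ 2 - βbar) :
    olFlow βbar g0 (k + 1) = 1 / Real.sqrt (1 / (olFlow βbar g0 k) ^ 2 - βbar) := by
  show (if 0 < 1 / (olFlow βbar g0 k) ^ 2 - βbar then _ else _) = _
  rw [if_pos h]

/-- the forward step: positivity and the recursion `1∕g_{k+1}² = 1∕g_k² − β̄` under the guard [folklore] -/
theorem olFlow_step {βbar g0 : ℝ} {k : ℕ} (h : 0 < 1 / (olFlow βbar g0 k) ^ 2 - βbar) :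
    0 < olFlow βbar g0 (k + 1) ∧ 1 / (olFlow βbar g0 (k + 1)) ^ 2 = 1 / (olFlow βbar g0 k) ^ 2 - βbar := by
  rw [olFlow_succ_of_pos h]
  refine ⟨by positivity, ?_⟩
  rw [one_div_pow, Real.sq_sqrt h.le, one_div_one_div]

/-- `constHBeta 1` satisfies the cell's β-hypothesis `BetaPertHyp` (`β̄ := 1 > 0`, remainder constant `C := 0`; a
constant is continuous on every box). [folklore] -/
theorem betaPertHyp_constHBeta : BetaPertHyp (constHBeta 1) := by
  refine ⟨⟨1, one_pos, 1, one_pos, 0, le_rfl, fun γ _ _ k v _ => ?_⟩, 1, one_pos, fun k => continuousOn_const⟩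
  simp [constHBeta]

/-! ## §3 The datum -/

section Datum

variable (F : T4Family)

/-- the trivial small-loop block averagings on `SU(1)` [folklore] -/
def jointAv : (K j : ℕ) → Averaging (F.P K) j SU1 := fun _ _ => BlockAveraging.blockAvg (LoopAverage.trivial SU1)

/-- **THE JOINT CONSTRUCTION** (placeholder pattern of `T4FiniteEpsInhabited.stubConstruction` over `SU(1)`): one-loop
forward flow with β-functions `≡ 1`; configurations = gauge fields of the `K`-th torus; densities `≡ 1`; `χ := 1`;
`Sect2Form := True`; `numSites := 0`, `wilsonBG = effAction = Ek := 0`, `dom := ∅`, `Repr = IndAss := False`.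
It asserts NONE of Bałaban's representations. [decided toy] -/
def jointConstruction : B16.Construction := fun p =>
  { flow := ⟨olFlow 1 p.g0, fun _ _ => 1⟩
    Cfg := fun k => GaugeField (F.P p.K) k SU1
    dom := fun _ => ∅
    effAction := fun _ _ => 0
    wilsonBG := fun _ _ => 0
    Ek := fun _ _ => 0
    numSites := fun _ => 0
    Repr := fun _ => False
    IndAss := fun _ => False
    ρ := fun _ _ => 1
    χ := fun _ _ => 1
    Sect2Form := fun _ => True }

/-- its one-variable β-functions are the constant family curried (both sides are `1`) [folklore] -/
theorem curriesHBeta_joint : DagBinding.CurriesHBeta (jointConstruction F).toB12 (constHBeta 1) :=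
  fun _ _ _ _ => rfl

/-- its flows are generated FORWARD from the bare coupling by `constHBeta 1` (`olFlow_step`) [folklore] -/
theorem forwardGenerated_joint : DagBinding.ForwardGenerated (jointConstruction F).toB12 (constHBeta 1) := by
  refine ⟨fun _ => rfl, fun p k _ _ hguard => ?_⟩
  exact olFlow_step (βbar := 1) (g0 := p.g0) hguard

/-- **THE REALISATION**: `cfg := id`; `ρ₀ = 1 = 1 · e^{−g₀⁻² A}` since the Boltzmann weight of `SU(1)` is `1`;
`Tρ_k := 1` IS the transform of `ρ_k = 1` along any averaging (`isRT_one_SU1`); `R := id`. [decided toy] -/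
def jointRealisation : Realisation F SU1 (jointConstruction F) (jointAv F) where
  cfg := fun _ _ _ => Equiv.refl _
  rho_zero := fun K g₀ => ⟨1, one_pos, fun U => by
    show (1 : ℝ) = 1 * Missing.boltzmann (F.P K) (g₀⁻¹ ^ 2) U
    rw [boltzmann_SU1, mul_one]⟩
  Trho := fun _ _ _ => fun _ => 1
  isRT_Trho := fun K _ k _ => isRT_one_SU1 (jointAv F K k).avg
  R := fun _ _ _ => id
  preservesIntegral_R := fun _ _ _ _ _ => rfl
  rho_succ_eq := fun _ _ _ _ => rfl

/-- **THE JOINT DATUM** `jointData F : FiniteEpsData F SU(1)`. [decided toy] -/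
def jointData : FiniteEpsData F SU1 where
  C := jointConstruction F
  βfun := constHBeta 1
  curries := curriesHBeta_joint F
  fwd := forwardGenerated_joint F
  av := jointAv F
  real := jointRealisation F

/-- its construction [decided toy] -/
@[simp] theorem jointData_C : (jointData F).C = jointConstruction F := rfl
/-- its β-family [decided toy] -/
@[simp] theorem jointData_βfun : (jointData F).βfun = constHBeta 1 := rfl
/-- its averagings [decided toy] -/
@[simp] theorem jointData_av : (jointData F).av = jointAv F := rfl

/-! ## §4 The binders the datum meets, and its integrals -/

/-- Theorem 1's typed form holds (its form-clause is `True` on the datum). [decided toy] -/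
theorem thm1Printed_jointData : B16.Thm1Printed (jointData F).C :=
  ⟨1, one_pos, fun _ _ _ _ => trivial⟩

/-- [III] Cor. 3 (2.50) holds with `e_± := 0`: `1·e^{−g⁻²·0 − 0·0} ≤ 1 ≤ e^{0·0}`. [decided toy] -/
theorem cor3_jointData : B16.Cor3_250 (jointData F).C := by
  refine ⟨1, one_pos, fun _ => 0, fun _ => 0, fun P _ k _ V => ?_⟩
  show (1 : ℝ) * Real.exp (-(1 / (olFlow 1 P.g0 k) ^ 2 * 0) - 0 * ((0 : ℕ) : ℝ)) ≤ 1 ∧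
    (1 : ℝ) ≤ Real.exp (0 * ((0 : ℕ) : ℝ))
  simp

/-- **(B) HOLDS ON THE DATUM** (the pin `EndStatementBPrinted = Thm1Printed ∧ Cor3_250`). [decided toy] -/
theorem endStatementBPrinted_jointData : B16.EndStatementBPrinted (jointData F).C :=
  ⟨thm1Printed_jointData F, cor3_jointData F⟩

/-- the sign convention `χ ≥ 0` (`χ := 1`) [decided toy] -/
theorem signConventions_jointData : B16.SignConventions (jointData F).C := fun _ _ _ => zero_le_one

/-- **`BetaPertHyp` HOLDS ON THE DATUM.** [decided toy] -/
theorem betaPertHyp_jointData : BetaPertHyp (jointData F).βfun := betaPertHyp_constHBeta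

/-- **THE DATUM IS BLOCK-AVERAGED** by the trivial small-loop average. [decided toy] -/
theorem isBlockAveraged_jointData : (jointData F).IsBlockAveraged (LoopAverage.trivial SU1) := fun _ _ => rfl

/-- its averagings are measurable [decided toy] -/
theorem avgMeasurable_jointData : (jointData F).AvgMeasurable :=
  fun _ _ => BlockAveraging.measurable_avgFun _ LoopAverage.measurableE_trivial

/-- every transported density of the datum is `1` [decided toy] -/
@[simp] theorem dens_jointData (K : ℕ) (g₀ : ℝ) (k : ℕ) (U : GaugeField (F.P K) k SU1) :
    (jointData F).dens K g₀ k U = 1 := rfl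

/-- the site count is `0` [decided toy] -/
@[simp] theorem numSites_jointData (K : ℕ) (g₀ : ℝ) (k : ℕ) : ((jointData F).C ⟨K, F.m, g₀⟩).numSites k = 0 := rfl

/-- the run's flow is the one-loop forward flow from its bare coupling [decided toy] -/
@[simp] theorem flow_jointData (K : ℕ) (g₀ : ℝ) : ((jointData F).C ⟨K, F.m, g₀⟩).flow.g = olFlow 1 g₀ := rfl

/-- **THE (γ) SMALL-FIELD MASS OF THE DATUM IS `1`**: `∫ 1 · e^{−g_K⁻²·0} dV = 1`. [decided toy] -/
theorem smallFieldMass_jointData (K : ℕ) (g₀ : ℝ) : smallFieldMass (jointData F) K g₀ = 1 := by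
  unfold smallFieldMass
  rw [integral_unique_prob]
  show (1 : ℝ) * Real.exp (-(1 / (olFlow 1 g₀ K) ^ 2 * 0)) = 1
  simp

/-- **EVERY UNIT-SCALE AVERAGED LOOP VARIABLE OF THE DATUM IS `1`.** [decided toy] -/
@[simp] theorem avgObs_jointData (K : ℕ) (C : ULoop F) (U : GaugeField (F.P K) 0 SU1) :
    (jointData F).avgObs K C U = 1 := loopAt_SU1 _ _

/-- hence every product observable of the scheme is `1` [decided toy] -/
@[simp] theorem prodObs_jointData (g₀ : ℕ → ℝ) (K : ℕ) (os : List (ULoop F)) (U : GaugeField (F.P K) 0 SU1) :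
    T4GenFunBounds.prodObs ((jointData F).scheme g₀) K os U = 1 := by
  unfold T4GenFunBounds.prodObs
  have : (os.map fun o => ((jointData F).scheme g₀).obs K o U) = os.map fun _ => (1 : ℝ) :=
    List.map_congr_left fun o _ => avgObs_jointData F K o U
  rw [this, List.map_const', List.prod_replicate, one_pow]

/-- **TUNED BARE SEQUENCES EXIST ON THE DATUM** for all small `γ`, `g` (endpoint existence from `BetaPertHyp` by the
tree's shooting argument): the `∀` of `ForSmallCouplings (jointData F)` does NOT range over an empty set. [decided toy] -/
theorem exists_tuned_jointData :
    ∃ γ₀ : ℝ, 0 < γ₀ ∧ ∀ γ : ℝ, 0 < γ → γ ≤ γ₀ → ∃ g₁ : ℝ, 0 < g₁ ∧ ∀ g : ℝ, 0 < g → g ≤ g₁ →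
      ∃ g₀ : ℕ → ℝ, (jointData F).Tuned γ g g₀ :=
  (jointData F).exists_tuned_of_betaPertHyp (betaPertHyp_jointData F)

end Datum

end

end Summit.QuantumFields.BalabanUV.T4Continuum.HistoryRealiseCellsRunAssemblyWTVSJointDatum
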